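import Mathlib
import HarnessLib
import Literature.NumberTheory.GaloisRepresentations.WildInertia
import Literature.NumberTheory.GaloisRepresentations.FundamentalCharacterCyclotomicProofs
import Literature.NumberTheory.GaloisRepresentations.TameInertiaCharacterProofs

/-!
# Stub `stub_modPCyclotomicOnInertia`
# (line `local_clause_cut`, crux `EmptyWeightCore`, stmt-Langlands-17008)

Let `K` be a `p`-adic field with `e = f = 1`: residue field `𝔽_p` (`residueFieldCard K = p`) and
`p` a uniformiser (`Irreducible (p : 𝒪[K])`).  Two facts about the mod `p` cyclotomic character
`ω̄ = modPCyclotomicCharacterZMod K p : Γ_K →* 𝔽_pˣ`: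

* (a) `ω̄` is trivial on the wild inertia group `P_K = absWildInertia K p`;
* (b) `ω̄` is onto `𝔽_pˣ` on the inertia group `I_K`: some `σ₀ ∈ I_K` has `ω̄(σ₀)` of exact
  order `p - 1`.

Proof.  Take for coefficient field the residue field `k₀ = S ⧸ 𝔓` of `K̄`
(`S = absIntegers 𝒪[K] K`, `𝔓 = absMaximalIdeal K`, a field by `absMaximalIdeal_isMaximal_holds`),
with the discrete topology, `ι = id` and `ι' : 𝔽_p → k₀` the canonical map (`k₀` has
characteristic `p`, `charP_of_residueEmbedding`).  By Serre's `θ_{p-1} = χ` for `e = 1`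
(`coe_fundamentalCharacter_one_eq_modPCyclotomicCharacter`), `ι' (ω̄ σ) = ψ₁(σ)` on `I_K`, where
`ψ₁ = fundamentalCharacter K 1 ι p _` is the Kummer character `θ_{p-1}` of `p`.  (a) `θ_d`
kills `P_K` for `p ∤ d` (`kummerCharacterQuot_eq_one_of_mem_absWildInertia`), and `ι'` is
injective.  (b) `θ_{p-1}` reaches a primitive `(p-1)`-th root of unity
(`exists_isPrimitiveRoot_kummerCharacter`, Serre 1972 §1.3 Prop. 2), and primitive roots are
reflected along the injective `ι'` (`IsPrimitiveRoot.of_map_of_injective`).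

Reference: J.-P. Serre, *Propriétés galoisiennes des points d'ordre fini des courbes elliptiques*,
Invent. Math. 15 (1972), §1.3 Prop. 2, §1.7, §1.8 Prop. 8 and Cor.  No `sorry`, no new definitions.
-/

-- project-wide option (lakefile weak.linter.dupNamespace); `Summit.Langlands.Langlands` is mandated
set_option linter.dupNamespace false

noncomputable section

namespace Summit.Langlands.Langlands.Cruxes.EmptyWeightCore.LocalClauseCut

open Literature.NumberTheory.GaloisRepresentations Field ValuativeRel
open Literature.NumberTheory.GaloisRepresentations.IsNonarchimedeanLocalField (residueFieldCard)

/-- **The mod `p` cyclotomic character on inertia, for `e = f = 1`.**  Let `K` be a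
non-archimedean local field of characteristic `0` with residue field `𝔽_p`
(`residueFieldCard K = p`) in which `p` is a uniformiser (`Irreducible (p : 𝒪[K])`).  Then the
mod `p` cyclotomic character `ω̄ = modPCyclotomicCharacterZMod K p` is (a) trivial on the wild
inertia group `absWildInertia K p`, and (b) takes at some `σ₀ ∈ I_K = absInertia K` a value of
exact order `p - 1` (a primitive `(p-1)`-th root of unity of `𝔽_p`), i.e. `ω̄|I_K` is onto `𝔽_pˣ`.
Both follow from Serre's identification `θ_{p-1} = χ` on `I_K` for `e = 1`
(`coe_fundamentalCharacter_one_eq_modPCyclotomicCharacter`, read in the residue field `S ⧸ 𝔓` of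
`K̄`): the Kummer character `θ_{p-1}` kills wild inertia
(`kummerCharacterQuot_eq_one_of_mem_absWildInertia`) and reaches a primitive `(p-1)`-th root of
unity (`exists_isPrimitiveRoot_kummerCharacter`).
[cite: SerreInventiones1972, §1.3 Prop. 2, §1.7 and §1.8 Prop. 8 with Cor.] -/
theorem stub_modPCyclotomicOnInertia :
    ∀ (K : Type) [Field K] [ValuativeRel K] [TopologicalSpace K] [IsNonarchimedeanLocalField K]
      [CharZero K] (p : ℕ) [Fact p.Prime],
      residueFieldCard K = p → Irreducible ((p : ℕ) : 𝒪[K]) →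
      (∀ σ ∈ absWildInertia K ((p : ℕ) : 𝒪[K]), modPCyclotomicCharacterZMod K p σ = 1) ∧
        ∃ σ₀ ∈ absInertia K,
          IsPrimitiveRoot ((modPCyclotomicCharacterZMod K p σ₀ : (ZMod p)ˣ) : ZMod p) (p - 1) := by
  intro K _ _ _ _ _ p _ hq hirr
  have hp : p.Prime := Fact.out
  -- the residue characteristic of `K` is `p`
  have hchar : ringChar 𝓀[K] = p := by
    obtain ⟨f, -, hf⟩ := IsNonarchimedeanLocalField.residueFieldCard_eq_pow_ringChar K
    rw [hq] at hf
    exact (hp.pow_eq_iff.1 hf.symm).1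
  -- the exponent `q ^ 1 - 1 = p - 1` of the level-one fundamental character
  have hn : 0 < residueFieldCard K ^ 1 - 1 :=
    residueFieldCard_pow_sub_one_pos K one_ne_zero
  have hexp : residueFieldCard K ^ 1 - 1 = p - 1 := by rw [pow_one, hq]
  have hpd : ¬ ringChar 𝓀[K] ∣ residueFieldCard K ^ 1 - 1 := by
    rw [hchar, hexp]
    intro h
    have h1 := Nat.le_of_dvd (by rw [← hexp]; exact hn) h
    have h2 := hp.two_le
    omega
  -- the residue field `k₀ = S ⧸ 𝔓` of `K̄`, a discrete field of characteristic `p`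
  haveI : (IsNonarchimedeanLocalField.absMaximalIdeal K).IsMaximal :=
    IsNonarchimedeanLocalField.absMaximalIdeal_isMaximal_holds K
  letI : Field (absIntegers 𝒪[K] K ⧸ IsNonarchimedeanLocalField.absMaximalIdeal K) :=
    Ideal.Quotient.field _
  letI : TopologicalSpace (absIntegers 𝒪[K] K ⧸ IsNonarchimedeanLocalField.absMaximalIdeal K) := ⊥
  haveI : DiscreteTopology (absIntegers 𝒪[K] K ⧸ IsNonarchimedeanLocalField.absMaximalIdeal K) :=
    ⟨rfl⟩
  haveI : CharP (absIntegers 𝒪[K] K ⧸ IsNonarchimedeanLocalField.absMaximalIdeal K) p := by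
    rw [← hchar]
    exact charP_of_residueEmbedding (RingHom.id _)
  set ι' : ZMod p →+* absIntegers 𝒪[K] K ⧸ IsNonarchimedeanLocalField.absMaximalIdeal K :=
    ZMod.castHom (dvd_refl p) _
  have hι' : Function.Injective ι' := ι'.injective
  -- Serre, §1.8 Cor.: `ι' (ω̄ σ) = ψ₁(σ)` for `σ ∈ I_K`
  have key : ∀ σ : absInertia K,
      ι' (modPCyclotomicCharacterZMod K p (σ : absoluteGaloisGroup K) : ZMod p) =
        (fundamentalCharacter K 1 (RingHom.id _) ((p : ℕ) : 𝒪[K]) hirr σ :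
          absIntegers 𝒪[K] K ⧸ IsNonarchimedeanLocalField.absMaximalIdeal K) := by
    intro σ
    rw [coe_fundamentalCharacter_one_eq_modPCyclotomicCharacter hirr hq (RingHom.id _) ι' σ,
      coe_modPCyclotomicCharacter_apply]
  refine ⟨fun σ hσ => ?_, ?_⟩
  · -- (a) `θ_{p-1}` kills `P_K`
    have hσI : σ ∈ absInertia K := absWildInertia_le_absInertia K _ hσ
    have h1 : kummerCharacterQuot K hn hirr.ne_zero ⟨σ, hσ.1⟩ = 1 :=
      kummerCharacterQuot_eq_one_of_mem_absWildInertia hirr.ne_zero hσ hn hpd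
    have h2 : (fundamentalCharacter K 1 (RingHom.id _) ((p : ℕ) : 𝒪[K]) hirr ⟨σ, hσI⟩ :
        absIntegers 𝒪[K] K ⧸ IsNonarchimedeanLocalField.absMaximalIdeal K) = 1 := by
      rw [fundamentalCharacter_of_ne_zero K one_ne_zero, coe_kummerCharacter_apply,
        RingHom.id_apply]
      exact h1
    have h3 : ι' (modPCyclotomicCharacterZMod K p σ : ZMod p) = ι' 1 := by
      rw [map_one, key ⟨σ, hσI⟩, h2]
    exact Units.val_eq_one.mp (hι' h3)
  · -- (b) `θ_{p-1}` reaches a primitive `(p-1)`-th root of unity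
    obtain ⟨σ₀, hσ₀⟩ := exists_isPrimitiveRoot_kummerCharacter (F := K)
      (k := absIntegers 𝒪[K] K ⧸ IsNonarchimedeanLocalField.absMaximalIdeal K) (RingHom.id _) hn
      hpd hirr
    refine ⟨σ₀, σ₀.2, ?_⟩
    rw [← fundamentalCharacter_of_ne_zero K one_ne_zero _ _ hirr, ← IsPrimitiveRoot.coe_units_iff,
      ← key σ₀, hexp] at hσ₀
    exact hσ₀.of_map_of_injective hι'

end Summit.Langlands.Langlands.Cruxes.EmptyWeightCore.LocalClauseCut

end
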